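import Literature.Probability.RandomPlanarGeometry.HullHausdorffCapacity
import Literature.Probability.RandomPlanarGeometry.HullThickening
import Literature.Probability.RandomPlanarGeometry.LoewnerHullCapacity
import Literature.Probability.RandomPlanarGeometry.LSW2004USTProofs
import HarnessLib

/-!
# Limits of Loewner-parametrised curves are Loewner curves (Kemppainen–Smirnov, Lemma A.4)

Topic `Literature/Probability/RandomPlanarGeometry` (family `crit-ising`); theorems only, no
definition and no named fact.

A. Kemppainen, S. Smirnov, *Random curves, scaling limits and Loewner evolutions*, Ann. Probab.
45 (2017), App. A, Lemma A.4 (arXiv:1212.6215, Lemma 5.5, "Main lemma"): for simple curves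
`γ_n : [0, T] → ℂ` from real points into `ℍ` with capacity clocks
`υ_n(t) = hcap(γ_n[0, t])/2` and driving terms `W_n`, IF `γ_n → γ` uniformly, `W_n → W`
uniformly, and (their third hypothesis, on the hyperbolic geodesics `F_n`, which they only use
to show that) the limit clock `υ` is strictly increasing, THEN "`g_t := g_{γ∘υ⁻¹[0,t]}` satisfies
the Loewner equation with the driving term `W`", i.e. (proof, last sentence) "`g_t` is
generated by `γ` and driven by `W`"; the proof reads: `υ_n → υ` uniformly (Lemma A.2),
`υ_n⁻¹ → υ⁻¹` uniformly, `γ_n ∘ υ_n⁻¹ → γ ∘ υ⁻¹` uniformly, then Lemma A.3 (driving-term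
stability) and the Carathéodory kernel theorem.

This file PROVES the lemma in the tree's vocabulary, on the half-open parameter interval `[0, 1)`
of a chordal curve (the form produced by `USTPeano.exists_capacity_parametrisation` /
`SimpleCurveLoewner.lean` for the approximating simple curves) and with the strict growth of the
limit capacity as an explicit geometric hypothesis:

* `tendstoUniformlyOn_Icc_of_monotoneOn` (Pólya: pointwise convergence of monotone functions to
  a continuous limit is uniform), `tendstoUniformlyOn_inverse_clock` (inverse clocks converge),
  `tendstoUniformlyOn_comp_clock` (reparametrised curves converge) — the elementary steps
  "`υ_n⁻¹ → υ⁻¹`", "`γ_n ∘ υ_n⁻¹ → γ ∘ υ⁻¹`" of the printed proof (KS invoke Helly's selection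
  theorem; monotonicity makes a direct argument available);
* **`exists_capacity_parametrisation_of_limit`** — let `η_n : [0, 1) → ℂ` have capacity clocks
  `θ_n` (continuous, strictly increasing, `θ_n(0) = 0`, `θ_n → ∞`) and capacity parametrisations
  `γ̂_n` (`γ̂_n (θ_n u) = η_n u`) generating the Loewner chains of continuous `W_n`; let
  `η_n → η` uniformly on every `[0, s]`, `η` continuous with `im η(0) = 0`, `W_n → W` locally
  uniformly; suppose the capacity of `η[0, s]` grows strictly (`η` keeps leaving its past hull)
  and tends to `∞`. Then the limit clock `θ(s) = hcap(Fill η[0, s])/2` is continuous, strictly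
  increasing, `θ_n → θ` uniformly on every `[0, s]` (Lemma A.2, `HullHausdorffCapacity.lean`, and
  Pólya), the capacity parametrisation `γ̂ = η ∘ θ⁻¹` is the locally uniform limit of the `γ̂_n`,
  and **the Loewner chain of `W` is generated by `γ̂`** (Lawler–Schramm–Werner 2004, Lemma 3.14,
  `Loewner.isGeneratedByCurve_of_tendstoLocallyUniformly'`, `SLETraceEightKernel.lean`);
* `diff_hull_eq_unboundedComponent_of_clock`, `tendsto_clock_of_tendstoUniformlyOn`,
  `im_sq_le_two_mul_hcap_of_tendstoUniformlyOn` — the hull at the capacity time `θ s` is the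
  fill of `η[0, s]`; `2 θ_n(s) → hcap (Fill η[0, s])`; `(im η s)² ≤ 2 hcap (Fill η[0, s])`
  for limits of curves in `ℍ̄`; hence `exists_capacity_parametrisation_of_limit_of_im`, the
  main lemma with the capacity divergence replaced by unboundedness of `im η`;
* `exists_capacity_parametrisation_of_limit_core` (strict growth of the capacity as hypothesis),
  `hcap_hpFill_image_Icc_mono`, `hcap_hpFill_image_Icc_lt_of_exit`, and
  **`exists_capacity_parametrisation_of_limit_of_tipModulus`** — Kemppainen–Smirnov's own
  hypotheses (Lemmas A.5, A.7): `η` not constant on any subinterval and a uniform modulus of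
  the tip approach `|f_{n,θ_n u}(W_n(θ_n u) + iy) - η_n(u)| ≤ ψ(y) → 0`.

## References

* A. Kemppainen, S. Smirnov, Ann. Probab. 45 (2017), App. A, Lemmas A.2–A.4 (arXiv:1212.6215,
  Lemmas 5.3–5.5). [KemppainenSmirnov2017]
* G. F. Lawler, O. Schramm, W. Werner, Ann. Probab. 32 (2004), Lemma 3.14.
  [LawlerSchrammWerner2004]
* G. F. Lawler, *Conformally Invariant Processes in the Plane*, AMS (2005), §4.1.
  [Lawler2005]
-/

noncomputable section

open Set Filter Topology Metric Bornology Complex Function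
open UpperHalfPlane (upperHalfPlaneSet isOpen_upperHalfPlaneSet)
open scoped NNReal

namespace Literature.Probability.RandomPlanarGeometry

/-! ### Clocks: elementary convergence lemmas -/

/-- **Pólya's lemma**: monotone functions converging pointwise on `[a, b]` to a continuous
limit converge uniformly on `[a, b]`. (The step "`υ_n → υ` uniformly" of Kemppainen–Smirnov's
Lemma A.4, given pointwise convergence of the capacities.) [folklore] -/
theorem tendstoUniformlyOn_Icc_of_monotoneOn {f : ℕ → ℝ → ℝ} {g : ℝ → ℝ} {a b : ℝ}
    (hf : ∀ n, MonotoneOn (f n) (Icc a b)) (hg : ContinuousOn g (Icc a b))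
    (hlim : ∀ x ∈ Icc a b, Tendsto (fun n ↦ f n x) atTop (𝓝 (g x))) :
    TendstoUniformlyOn f g atTop (Icc a b) := by
  rcases lt_or_ge b a with hba | hab
  · rw [Icc_eq_empty (not_le.2 hba)]
    exact tendstoUniformlyOn_empty
  rw [Metric.tendstoUniformlyOn_iff]
  intro ε hε
  -- uniform continuity of `g`
  obtain ⟨δ, hδ, hU⟩ := Metric.uniformContinuousOn_iff.1
    (isCompact_Icc.uniformContinuousOn_of_continuous hg) (ε / 2) (half_pos hε)
  -- the partition `x i = a + i h`, `h = (b - a)/m < δ`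
  obtain ⟨m, hm⟩ : ∃ m : ℕ, (b - a) / δ < m := exists_nat_gt _
  have hm0 : 0 < m := by
    have : (0 : ℝ) < m := lt_of_le_of_lt (div_nonneg (sub_nonneg.2 hab) hδ.le) hm
    exact_mod_cast this
  have hm0' : (0 : ℝ) < m := by exact_mod_cast hm0
  set h : ℝ := (b - a) / m with hh
  have hh0 : 0 ≤ h := div_nonneg (sub_nonneg.2 hab) hm0'.le
  have hhδ : h < δ := by
    rw [hh, div_lt_iff₀ hm0']
    rw [div_lt_iff₀ hδ] at hm
    linarith
  set x : ℕ → ℝ := fun i ↦ a + i * h with hx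
  have hxmem : ∀ i, i ≤ m → x i ∈ Icc a b := by
    intro i hi
    have hi' : (i : ℝ) ≤ m := by exact_mod_cast hi
    refine ⟨by simp only [hx]; nlinarith, ?_⟩
    simp only [hx]
    have : (i : ℝ) * h ≤ m * h := mul_le_mul_of_nonneg_right hi' hh0
    have hmh : (m : ℝ) * h = b - a := by rw [hh]; field_simp
    linarith
  -- eventually all nodes are `ε/2`-close
  have hnodes : ∀ᶠ n in atTop, ∀ i ∈ Finset.range (m + 1), dist (g (x i)) (f n (x i)) < ε / 2 := by
    refine (Finset.range (m + 1)).eventually_all.2 fun i hi ↦ ?_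
    have him : i ≤ m := Nat.lt_succ_iff.1 (Finset.mem_range.1 hi)
    exact (Metric.tendsto_nhds.1 (hlim (x i) (hxmem i him))) (ε / 2) (half_pos hε) |>.mono
      fun n hn ↦ by rw [dist_comm]; exact hn
  filter_upwards [hnodes] with n hn y hy
  -- locate `y` between two consecutive nodes
  rcases eq_or_lt_of_le hy.2 with hyb | hyb
  · -- `y = b = x m`
    have hxm : x m = b := by
      simp only [hx, hh]; field_simp; ring
    have := hn m (Finset.mem_range.2 (Nat.lt_succ_self m))
    rw [hxm] at this
    rw [hyb]
    linarith [half_lt_self hε]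
  · rcases hh0.eq_or_lt with hh00 | hh00
    · -- degenerate mesh: `a = b`
      have hab' : b - a = 0 := by
        have : (b - a) / m = 0 := by rw [← hh, ← hh00]
        rcases div_eq_zero_iff.1 this with h1 | h1
        · exact h1
        · exact absurd h1 hm0'.ne'
      have hya : y = a := by linarith [hy.1]
      have hx0 : x 0 = a := by simp [hx]
      have := hn 0 (Finset.mem_range.2 (Nat.succ_pos m))
      rw [hx0] at this
      rw [hya]
      linarith [half_lt_self hε]
    · set i : ℕ := ⌊(y - a) / h⌋₊ with hi
      have hq0 : 0 ≤ (y - a) / h := div_nonneg (sub_nonneg.2 hy.1) hh0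
      have hi1 : (i : ℝ) ≤ (y - a) / h := Nat.floor_le hq0
      have hi2 : (y - a) / h < i + 1 := Nat.lt_floor_add_one _
      have hqm : (y - a) / h < m := by
        rw [div_lt_iff₀ hh00]
        have hmh : (m : ℝ) * h = b - a := by rw [hh]; field_simp
        linarith
      have him : i < m := by
        have : (i : ℝ) < m := lt_of_le_of_lt hi1 hqm
        exact_mod_cast this
      have hxi : x i ≤ y := by
        simp only [hx]
        rw [le_div_iff₀ hh00] at hi1
        linarith
      have hxi1 : y ≤ x (i + 1) := by
        simp only [hx]
        rw [div_lt_iff₀ hh00] at hi2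
        push_cast
        linarith
      have hdist1 : dist (x (i + 1)) y < δ := by
        rw [Real.dist_eq, abs_of_nonneg (by linarith)]
        simp only [hx] at hxi ⊢
        push_cast
        rw [le_div_iff₀ hh00] at hi1
        linarith
      have hdist0 : dist (x i) y < δ := by
        rw [dist_comm, Real.dist_eq, abs_of_nonneg (by linarith)]
        simp only [hx] at hxi1 ⊢
        push_cast at hxi1
        rw [div_lt_iff₀ hh00] at hi2
        linarith
      have hmem1 := hxmem (i + 1) him
      have hmem0 := hxmem i him.le
      have hg1 := hU (x (i + 1)) hmem1 y hy hdist1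
      have hg0 := hU (x i) hmem0 y hy hdist0
      have hf1 := hn (i + 1) (Finset.mem_range.2 (Nat.succ_lt_succ him))
      have hf0 := hn i (Finset.mem_range.2 (him.trans (Nat.lt_succ_self m)))
      rw [Real.dist_eq] at hg1 hg0 hf1 hf0 ⊢
      have hmono1 : f n y ≤ f n (x (i + 1)) := hf n hy hmem1 hxi1
      have hmono0 : f n (x i) ≤ f n y := hf n hmem0 hy hxi
      rw [abs_lt] at hg1 hg0 hf1 hf0 ⊢
      constructor <;> nlinarith [hg1.1, hg1.2, hg0.1, hg0.2, hf1.1, hf1.2, hf0.1, hf0.2]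

/-- **Inverse clocks converge** (the step "`υ_n⁻¹ → υ⁻¹` uniformly" of Kemppainen–Smirnov's
Lemma A.4). Let `θ : [0, 1) → [0, ∞)` be strictly increasing with `θ 0 = 0` and inverse
`σ : [0, ∞) → [0, 1)` continuous, and let `θ_n → θ` uniformly on every `[0, s] ⊆ [0, 1)`, with
strictly increasing `θ_n` and inverses `σ_n` (`θ_n (σ_n u) = u`, `σ_n u ∈ [0, 1)`). Then
`σ_n → σ` uniformly on every `[0, T]`. [folklore] -/
theorem tendstoUniformlyOn_inverse_clock {θ : ℝ → ℝ} {θn : ℕ → ℝ → ℝ} {σ : ℝ → ℝ}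
    {σn : ℕ → ℝ → ℝ}
    (hθm : StrictMonoOn θ (Ico 0 1)) (hθ0 : θ 0 = 0)
    (hσ : ∀ u, 0 ≤ u → σ u ∈ Ico (0 : ℝ) 1 ∧ θ (σ u) = u) (hσc : ContinuousOn σ (Ici 0))
    (hθnm : ∀ n, StrictMonoOn (θn n) (Ico 0 1))
    (hσn : ∀ n u, 0 ≤ u → σn n u ∈ Ico (0 : ℝ) 1 ∧ θn n (σn n u) = u)
    (hconv : ∀ s, s < 1 → TendstoUniformlyOn θn θ atTop (Icc 0 s)) {T : ℝ} (hT : 0 ≤ T) :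
    TendstoUniformlyOn σn σ atTop (Icc 0 T) := by
  rw [Metric.tendstoUniformlyOn_iff]
  intro ε hε
  -- the compact piece `[0, s₁]`, `s₁ = σ (T + 1)`
  obtain ⟨hs₁, hθs₁⟩ := hσ (T + 1) (by linarith)
  set s₁ : ℝ := σ (T + 1) with hs₁def
  -- uniform continuity of `σ` on `[0, T + 2]`
  obtain ⟨δ, hδ, hU⟩ := Metric.uniformContinuousOn_iff.1
    (isCompact_Icc.uniformContinuousOn_of_continuous
      (hσc.mono (Icc_subset_Ici_self : Icc (0 : ℝ) (T + 2) ⊆ _))) ε hε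
  set e : ℝ := min δ 1 / 2 with he
  have he0 : 0 < e := by positivity
  have heδ : e < δ := by
    have := min_le_left δ 1; rw [he]; linarith
  have he1 : e ≤ 1 / 2 := by
    have := min_le_right δ 1; rw [he]; linarith
  filter_upwards [(Metric.tendstoUniformlyOn_iff.1 (hconv s₁ hs₁.2)) e he0] with n hn u hu
  obtain ⟨hxnu, hθnxnu⟩ := hσn n u hu.1
  set xn : ℝ := σn n u with hxndef
  -- `xn ≤ s₁`: otherwise `θ_n xn > θ_n s₁ > θ s₁ - e = T + 1 - e > T ≥ u`
  have hxn_le : xn ≤ s₁ := by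
    by_contra hlt
    rw [not_le] at hlt
    have h1 : θn n s₁ < θn n xn := hθnm n hs₁ hxnu hlt
    have h2 : dist (θ s₁) (θn n s₁) < e := hn s₁ ⟨hs₁.1, le_rfl⟩
    rw [Real.dist_eq, abs_lt] at h2
    linarith [hu.2]
  -- `|θ xn - u| = |θ xn - θ_n xn| < e`
  have h3 : dist (θ xn) (θn n xn) < e := hn xn ⟨hxnu.1, hxn_le⟩
  rw [hθnxnu] at h3
  have hθxn0 : 0 ≤ θ xn := by
    have hmono := hθm.monotoneOn ⟨le_rfl, zero_lt_one⟩ hxnu hxnu.1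
    rwa [hθ0] at hmono
  have hθxnT : θ xn ≤ T + 2 := by
    rw [Real.dist_eq, abs_lt] at h3
    linarith [hu.2]
  have h4 := hU (θ xn) ⟨hθxn0, hθxnT⟩ u ⟨hu.1, by linarith [hu.2]⟩ (h3.trans heδ)
  -- `σ (θ xn) = xn`
  have h5 : σ (θ xn) = xn := by
    obtain ⟨hmem, heq⟩ := hσ (θ xn) hθxn0
    exact hθm.injOn hmem hxnu heq
  rw [h5] at h4
  rw [dist_comm]
  exact h4

/-- **Reparametrised curves converge** (the step "`γ_n ∘ υ_n⁻¹ → γ ∘ υ⁻¹`" of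
Kemppainen–Smirnov's Lemma A.4): if `η_n → η` uniformly on `[0, s₁]`, `η` is continuous on
`[0, s₁]`, and `σ_n → σ` uniformly on `[0, T]` with values in `[0, s₁]`, then
`η_n ∘ σ_n → η ∘ σ` uniformly on `[0, T]`. [folklore] -/
theorem tendstoUniformlyOn_comp_clock {E : Type*} [PseudoMetricSpace E] {η : ℝ → E}
    {ηn : ℕ → ℝ → E} {σ : ℝ → ℝ} {σn : ℕ → ℝ → ℝ} {s₁ T : ℝ}
    (hη : ContinuousOn η (Icc 0 s₁)) (hconv : TendstoUniformlyOn ηn η atTop (Icc 0 s₁))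
    (hσconv : TendstoUniformlyOn σn σ atTop (Icc 0 T))
    (hσmem : ∀ u ∈ Icc 0 T, σ u ∈ Icc 0 s₁)
    (hσnmem : ∀ᶠ n in atTop, ∀ u ∈ Icc 0 T, σn n u ∈ Icc 0 s₁) :
    TendstoUniformlyOn (fun n u ↦ ηn n (σn n u)) (fun u ↦ η (σ u)) atTop (Icc 0 T) := by
  rw [Metric.tendstoUniformlyOn_iff]
  intro ε hε
  obtain ⟨δ, hδ, hU⟩ := Metric.uniformContinuousOn_iff.1
    (isCompact_Icc.uniformContinuousOn_of_continuous hη) (ε / 2) (half_pos hε)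
  filter_upwards [(Metric.tendstoUniformlyOn_iff.1 hconv) (ε / 2) (half_pos hε),
    (Metric.tendstoUniformlyOn_iff.1 hσconv) δ hδ, hσnmem] with n hn hσn hmem u hu
  calc dist (η (σ u)) (ηn n (σn n u))
      ≤ dist (η (σ u)) (η (σn n u)) + dist (η (σn n u)) (ηn n (σn n u)) := dist_triangle _ _ _
    _ < ε / 2 + ε / 2 := add_lt_add (hU _ (hσmem u hu) _ (hmem u hu) (hσn u hu)) (hn _ (hmem u hu))
    _ = ε := by ring

/-! ### The fills of the initial segments of a curve depend continuously on the parameter -/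

/-- **Hausdorff continuity of initial segments**: for `η` continuous on `[0, s_max]` and
parameters `x_k → s₀` in `[0, s_max]`, the traces `η[0, x_k]` converge to `η[0, s₀]` in the
Hausdorff sense (both halves, as thickening inclusions). [folklore] -/
theorem eventually_image_Icc_subset_thickening_of_tendsto {η : ℝ → ℂ} {smax s₀ : ℝ}
    (hη : ContinuousOn η (Icc 0 smax)) {x : ℕ → ℝ} (hx : ∀ k, x k ∈ Icc 0 smax)
    (hs₀ : s₀ ∈ Icc 0 smax) (hlim : Tendsto x atTop (𝓝 s₀)) {ε : ℝ} (hε : 0 < ε) :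
    ∀ᶠ k in atTop, η '' Icc 0 (x k) ⊆ thickening ε (η '' Icc 0 s₀) ∧
      η '' Icc 0 s₀ ⊆ thickening ε (η '' Icc 0 (x k)) := by
  obtain ⟨δ, hδ, hU⟩ := Metric.uniformContinuousOn_iff.1
    (isCompact_Icc.uniformContinuousOn_of_continuous hη) ε hε
  filter_upwards [(Metric.tendsto_nhds.1 hlim) δ hδ] with k hk
  rw [Real.dist_eq, abs_lt] at hk
  constructor
  · rintro _ ⟨u, hu, rfl⟩
    rcases le_or_gt u s₀ with h | h
    · exact self_subset_thickening hε _ ⟨u, ⟨hu.1, h⟩, rfl⟩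
    · refine mem_thickening_iff.2 ⟨η s₀, ⟨s₀, ⟨hs₀.1, le_rfl⟩, rfl⟩, ?_⟩
      refine hU u ⟨hu.1, hu.2.trans (hx k).2⟩ s₀ hs₀ ?_
      rw [Real.dist_eq, abs_lt]
      constructor <;> linarith [hu.2]
  · rintro _ ⟨u, hu, rfl⟩
    rcases le_or_gt u (x k) with h | h
    · exact self_subset_thickening hε _ ⟨u, ⟨hu.1, h⟩, rfl⟩
    · refine mem_thickening_iff.2 ⟨η (x k), ⟨x k, ⟨(hx k).1, le_rfl⟩, rfl⟩, ?_⟩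
      refine hU u ⟨hu.1, hu.2.trans hs₀.2⟩ (x k) (hx k) ?_
      rw [Real.dist_eq, abs_lt]
      constructor <;> linarith [hu.2]

/-! ### Hulls and capacities of a capacity parametrisation -/

/-- A continuous clock with `θ 0 = 0` maps `[0, s]` onto `[0, θ s]`. [folklore] -/
theorem image_Icc_eq_of_clock {θ : ℝ → ℝ≥0} (hθc : ContinuousOn θ (Ico 0 1))
    (hθm : StrictMonoOn θ (Ico 0 1)) (hθ0 : θ 0 = 0) {s : ℝ} (hs : s ∈ Ico (0 : ℝ) 1) :
    θ '' Icc 0 s = Icc (0 : ℝ≥0) (θ s) := by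
  have hIcc_sub : Icc (0 : ℝ) s ⊆ Ico 0 1 := fun u hu ↦ ⟨hu.1, hu.2.trans_lt hs.2⟩
  refine Subset.antisymm ?_ ?_
  · rintro _ ⟨u, hu, rfl⟩
    refine ⟨?_, hθm.monotoneOn (hIcc_sub hu) hs hu.2⟩
    have := hθm.monotoneOn ⟨le_rfl, zero_lt_one⟩ (hIcc_sub hu) hu.1
    rwa [hθ0] at this
  · have h1 := intermediate_value_Icc hs.1 (hθc.mono hIcc_sub)
    rwa [hθ0] at h1

/-- **The hull at the capacity time `θ s` is the fill of the initial segment `η[0, s]`**: if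
`γ̂ (θ u) = η u` on `[0, 1)` and `γ̂` generates the chain of `W`, then
`ℍ ∖ K_{θ s}` is the unbounded component of `ℍ ∖ η[0, s]`.
[cite: Lawler2005, Ch. 4 §4.1] -/
theorem diff_hull_eq_unboundedComponent_of_clock {η : ℝ → ℂ} {θ : ℝ → ℝ≥0} {γ : ℝ≥0 → ℂ}
    {W : ℝ≥0 → ℝ} (hθc : ContinuousOn θ (Ico 0 1)) (hθm : StrictMonoOn θ (Ico 0 1))
    (hθ0 : θ 0 = 0) (hγθ : ∀ u ∈ Ico (0 : ℝ) 1, γ (θ u) = η u)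
    (hgen : Loewner.IsGeneratedByCurve W γ) {s : ℝ} (hs : s ∈ Ico (0 : ℝ) 1) :
    upperHalfPlaneSet \ Loewner.hull W (θ s) =
      Loewner.unboundedComponent (upperHalfPlaneSet \ η '' Icc 0 s) := by
  have hIcc_sub : Icc (0 : ℝ) s ⊆ Ico 0 1 := fun u hu ↦ ⟨hu.1, hu.2.trans_lt hs.2⟩
  have himage : γ '' Icc 0 (θ s) = η '' Icc 0 s := by
    rw [← image_Icc_eq_of_clock hθc hθm hθ0 hs, ← image_comp]
    exact image_congr fun u hu ↦ hγθ u (hIcc_sub hu)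
  rw [hgen.hull_eq, himage, sdiff_sdiff_cancel_left]
  exact (Loewner.unboundedComponent_subset _).trans sdiff_subset

/-- **The capacities of the approximants converge to the capacity of the fill of the limit
segment** (Kemppainen–Smirnov's Lemma A.2 along capacity parametrisations): with clocks `θ_n`
and capacity parametrisations `γ̂_n` of `η_n` generating the chains of continuous `W_n`, and
`η_n → η` uniformly on `[0, s]`, `2 θ_n(s) → hcap (Fill η[0, s])` for every hydrodynamic map
of that fill. [cite: KemppainenSmirnov2017, App. A Lemma A.2] -/
theorem tendsto_clock_of_tendstoUniformlyOn {ηn : ℕ → ℝ → ℂ} {η : ℝ → ℂ}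
    {θn : ℕ → ℝ → ℝ≥0} {γn : ℕ → ℝ≥0 → ℂ} {Wn : ℕ → ℝ≥0 → ℝ}
    (hθc : ∀ n, ContinuousOn (θn n) (Ico 0 1)) (hθm : ∀ n, StrictMonoOn (θn n) (Ico 0 1))
    (hθ0 : ∀ n, θn n 0 = 0) (hγθ : ∀ n, ∀ u ∈ Ico (0 : ℝ) 1, γn n (θn n u) = ηn n u)
    (hWn : ∀ n, Continuous (Wn n)) (hgen : ∀ n, Loewner.IsGeneratedByCurve (Wn n) (γn n))
    (hc : ContinuousOn η (Ico 0 1)) {s : ℝ} (hs : s ∈ Ico (0 : ℝ) 1)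
    (hlim : TendstoUniformlyOn ηn η atTop (Icc 0 s))
    {K : Set ℂ} (hV : upperHalfPlaneSet \ K = Loewner.unboundedComponent (upperHalfPlaneSet \ η '' Icc 0 s))
    {φ : ConformalEquiv (upperHalfPlaneSet \ K) upperHalfPlaneSet} (hφ : IsHydrodynamicMap K φ) :
    Tendsto (fun n ↦ 2 * (θn n s : ℝ)) atTop (𝓝 (hcap K φ)) := by
  have hIcc_sub : Icc (0 : ℝ) s ⊆ Ico 0 1 := fun u hu ↦ ⟨hu.1, hu.2.trans_lt hs.2⟩
  have hmapn : ∀ n (t : ℝ≥0), ∃ ψ : ConformalEquiv (upperHalfPlaneSet \ Loewner.hull (Wn n) t)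
      upperHalfPlaneSet, IsHydrodynamicMap (Loewner.hull (Wn n) t) ψ ∧
        hcap (Loewner.hull (Wn n) t) ψ = 2 * t := by
    intro n t
    obtain ⟨ψ, hψ⟩ := Loewner.exists_conformalEquiv_map_holds (hWn n) t
    exact ⟨ψ, Loewner.isHydrodynamicMap_of_eqOn (hWn n) t hψ, Loewner.hcap_hull_eq (hWn n) t hψ⟩
  choose ψn hψn hcapn using hmapn
  have key := tendsto_hcap_image_Icc_of_tendstoUniformlyOn (hc.mono hIcc_sub) hlim
    (Kn := fun n ↦ Loewner.hull (Wn n) (θn n s)) (K := K)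
    (φn := fun n ↦ ψn n (θn n s)) (φ := φ)
    (fun n ↦ diff_hull_eq_unboundedComponent_of_clock (hθc n) (hθm n) (hθ0 n) (hγθ n) (hgen n) hs)
    hV (fun n ↦ hψn n (θn n s)) hφ
  exact key.congr fun n ↦ hcapn n (θn n s)

/-- **The capacity of the fill of a limit segment dominates `(im η s)²/2`**: along capacity
parametrisations of curves in `ℍ̄` converging uniformly on `[0, s]`, `(im η(s))² ≤ 2 hcap
(Fill η[0, s])` (`(im z)² ≤ 4t` on `K_t`, `Loewner.im_sq_le_of_mem_hull`, passed to the limit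
through `tendsto_clock_of_tendstoUniformlyOn`). In particular the capacity of `η[0, s]`
diverges as soon as `im η` is unbounded (Kemppainen–Smirnov's Lemma A.13:
`hcap K ≥ h²/4` when `K` reaches height `h`, in their normalisation).
[cite: KemppainenSmirnov2017, App. A Lemma A.2] [cite: Lawler2005, Ch. 4 §4.1 Thm. 4.6] -/
theorem im_sq_le_two_mul_hcap_of_tendstoUniformlyOn {ηn : ℕ → ℝ → ℂ} {η : ℝ → ℂ}
    {θn : ℕ → ℝ → ℝ≥0} {γn : ℕ → ℝ≥0 → ℂ} {Wn : ℕ → ℝ≥0 → ℝ}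
    (hθc : ∀ n, ContinuousOn (θn n) (Ico 0 1)) (hθm : ∀ n, StrictMonoOn (θn n) (Ico 0 1))
    (hθ0 : ∀ n, θn n 0 = 0) (hγθ : ∀ n, ∀ u ∈ Ico (0 : ℝ) 1, γn n (θn n u) = ηn n u)
    (hWn : ∀ n, Continuous (Wn n)) (hgen : ∀ n, Loewner.IsGeneratedByCurve (Wn n) (γn n))
    (himn : ∀ n, ∀ u ∈ Ico (0 : ℝ) 1, 0 ≤ (ηn n u).im)
    (hc : ContinuousOn η (Ico 0 1)) {s : ℝ} (hs : s ∈ Ico (0 : ℝ) 1)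
    (hlim : TendstoUniformlyOn ηn η atTop (Icc 0 s))
    {K : Set ℂ} (hV : upperHalfPlaneSet \ K = Loewner.unboundedComponent (upperHalfPlaneSet \ η '' Icc 0 s))
    {φ : ConformalEquiv (upperHalfPlaneSet \ K) upperHalfPlaneSet} (hφ : IsHydrodynamicMap K φ) :
    (η s).im ^ 2 ≤ 2 * hcap K φ := by
  have hcap_lim := tendsto_clock_of_tendstoUniformlyOn hθc hθm hθ0 hγθ hWn hgen hc hs hlim hV hφ
  -- `(im η_n s)² ≤ 4 θ_n s`
  have hbound : ∀ n, (ηn n s).im ^ 2 ≤ 4 * (θn n s : ℝ) := by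
    intro n
    rcases (himn n s hs).lt_or_eq with hpos | hzero
    · have hmem : ηn n s ∈ Loewner.hull (Wn n) (θn n s) := by
        rw [(hgen n).hull_eq]
        refine ⟨hpos, fun hU ↦ (Loewner.unboundedComponent_subset _ hU).2 ?_⟩
        exact ⟨θn n s, ⟨bot_le, le_rfl⟩, hγθ n s hs⟩
      exact Loewner.im_sq_le_of_mem_hull (hWn n) hmem
    · rw [← hzero]
      simp only [ne_eq, OfNat.ofNat_ne_zero, not_false_eq_true, zero_pow]
      positivity
  -- pass to the limit
  have him_lim : Tendsto (fun n ↦ (ηn n s).im ^ 2) atTop (𝓝 ((η s).im ^ 2)) :=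
    ((continuous_im.tendsto _).comp (hlim.tendsto_at ⟨hs.1, le_rfl⟩)).pow 2
  have h2 : Tendsto (fun n ↦ 2 * (2 * (θn n s : ℝ))) atTop (𝓝 (2 * hcap K φ)) :=
    hcap_lim.const_mul 2
  exact le_of_tendsto_of_tendsto him_lim h2 (Eventually.of_forall fun n ↦ by
    have := hbound n; linarith)

/-! ### The main lemma -/

/-- **The main lemma, core form**: `exists_capacity_parametrisation_of_limit` with the strict
growth of the limit capacity taken as the hypothesis `hstrict` ("`hcap (Fill η[0, s]) <
hcap (Fill η[0, s'])` for `s < s'`", for all hydrodynamic maps); the two published sufficient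
conditions — a point of `η(s, s']` outside the fill of `η[0, s]`
(`exists_capacity_parametrisation_of_limit`), and Kemppainen–Smirnov's "`γ` not constant on any
subinterval" together with a uniform modulus of the tip approach
(`exists_capacity_parametrisation_of_limit_of_tipModulus`, their Lemmas A.5/A.7) — are derived
from it below. [cite: KemppainenSmirnov2017, App. A Lemma A.4] [cite: LawlerSchrammWerner2004, Lemma 3.14] -/
theorem exists_capacity_parametrisation_of_limit_core
    {ηn : ℕ → ℝ → ℂ} {η : ℝ → ℂ} {θn : ℕ → ℝ → ℝ≥0} {γn : ℕ → ℝ≥0 → ℂ}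
    {Wn : ℕ → ℝ≥0 → ℝ} {W : ℝ≥0 → ℝ}
    (hθc : ∀ n, ContinuousOn (θn n) (Ico 0 1)) (hθm : ∀ n, StrictMonoOn (θn n) (Ico 0 1))
    (hθ0 : ∀ n, θn n 0 = 0) (hθinf : ∀ n, Tendsto (θn n) (𝓝[<] 1) atTop)
    (hγθ : ∀ n, ∀ u ∈ Ico (0 : ℝ) 1, γn n (θn n u) = ηn n u)
    (hWn : ∀ n, Continuous (Wn n)) (hgen : ∀ n, Loewner.IsGeneratedByCurve (Wn n) (γn n))
    (h0 : (η 0).im = 0) (hc : ContinuousOn η (Ico 0 1))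
    (hlim : ∀ s, s < 1 → TendstoUniformlyOn ηn η atTop (Icc 0 s))
    (hstrict : ∀ s s' (hs : s ∈ Ico (0 : ℝ) 1) (hs' : s' ∈ Ico (0 : ℝ) 1), s < s' →
      ∀ (φ : ConformalEquiv (upperHalfPlaneSet \ hpFill (η '' Icc 0 s)) upperHalfPlaneSet)
        (φ' : ConformalEquiv (upperHalfPlaneSet \ hpFill (η '' Icc 0 s')) upperHalfPlaneSet),
        IsHydrodynamicMap (hpFill (η '' Icc 0 s)) φ → IsHydrodynamicMap (hpFill (η '' Icc 0 s')) φ' →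
          hcap (hpFill (η '' Icc 0 s)) φ < hcap (hpFill (η '' Icc 0 s')) φ')
    (hdiv : ∀ M : ℝ, ∃ s ∈ Ico (0 : ℝ) 1,
      ∀ φ : ConformalEquiv (upperHalfPlaneSet \ hpFill (η '' Icc 0 s)) upperHalfPlaneSet,
        IsHydrodynamicMap (hpFill (η '' Icc 0 s)) φ → M ≤ hcap (hpFill (η '' Icc 0 s)) φ)
    (hW : Continuous W) (hWlim : TendstoLocallyUniformly Wn W atTop) :
    ∃ (θ : ℝ → ℝ≥0) (γ : ℝ≥0 → ℂ), ContinuousOn θ (Ico 0 1) ∧ StrictMonoOn θ (Ico 0 1) ∧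
      θ 0 = 0 ∧ Tendsto θ (𝓝[<] 1) atTop ∧ (∀ u ∈ Ico (0 : ℝ) 1, γ (θ u) = η u) ∧
      Continuous γ ∧ Loewner.IsGeneratedByCurve W γ ∧ TendstoLocallyUniformly γn γ atTop ∧
      ∀ s ∈ Ico (0 : ℝ) 1,
        TendstoUniformlyOn (fun n u ↦ (θn n u : ℝ)) (fun u ↦ (θ u : ℝ)) atTop (Icc 0 s) := by
  /- Step A: the hulls of the approximants at parameter `s` (`diff_hull_eq_unboundedComponent_of_clock`)
  and their capacity `2 θ_n s` enter through `tendsto_clock_of_tendstoUniformlyOn` -/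
  have hθmono : ∀ n, MonotoneOn (θn n) (Ico 0 1) := fun n ↦ (hθm n).monotoneOn
  have hIcc_sub : ∀ {s : ℝ}, s < 1 → Icc (0 : ℝ) s ⊆ Ico 0 1 := fun hs u hu ↦ ⟨hu.1, hu.2.trans_lt hs⟩
  /- Step B: the fills of the limit segments and their maps -/
  have hexl : ∀ s : ℝ, s ∈ Ico (0 : ℝ) 1 →
      ∃ φ : ConformalEquiv (upperHalfPlaneSet \ hpFill (η '' Icc 0 s)) upperHalfPlaneSet,
        IsHydrodynamicMap (hpFill (η '' Icc 0 s)) φ ∧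
          upperHalfPlaneSet \ hpFill (η '' Icc 0 s) =
            Loewner.unboundedComponent (upperHalfPlaneSet \ η '' Icc 0 s) := fun s hs ↦
    exists_isHydrodynamicMap_hpFill_image_Icc hs.1 (hc.mono (hIcc_sub hs.2)) h0
  choose φl hφl hVl using hexl
  -- the limit capacity `capl s = hcap (Fill η[0, s])` (junk `0` off `[0, 1)`)
  classical
  set capl : ℝ → ℝ := fun s ↦ if hs : s ∈ Ico (0 : ℝ) 1 then hcap (hpFill (η '' Icc 0 s)) (φl s hs)
    else 0 with hcapl
  have hcapl_eq : ∀ s (hs : s ∈ Ico (0 : ℝ) 1), capl s = hcap (hpFill (η '' Icc 0 s)) (φl s hs) :=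
    fun s hs ↦ by simp only [hcapl, dif_pos hs]
  have hbl : ∀ s, s ∈ Ico (0 : ℝ) 1 → IsBounded (hpFill (η '' Icc 0 s) ∩ upperHalfPlaneSet) :=
    fun s hs ↦ (isBounded_hpFill ((isCompact_Icc.image_of_continuousOn
      (hc.mono (hIcc_sub hs.2))).isBounded)).subset inter_subset_left
  /- Step C: pointwise convergence of the capacities (Lemma A.2) -/
  have hpt : ∀ s (hs : s ∈ Ico (0 : ℝ) 1),
      Tendsto (fun n ↦ 2 * (θn n s : ℝ)) atTop (𝓝 (capl s)) := by
    intro s hs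
    rw [hcapl_eq s hs]
    exact tendsto_clock_of_tendstoUniformlyOn hθc hθm hθ0 hγθ hWn hgen hc hs (hlim s hs.2)
      (hVl s hs) (hφl s hs)
  /- Step D: the limit capacity is `0` at `0`, nonnegative, strictly increasing, continuous,
  and tends to `∞` -/
  have hcapl_nonneg : ∀ s (hs : s ∈ Ico (0 : ℝ) 1), 0 ≤ capl s := fun s hs ↦ by
    rw [hcapl_eq s hs]; exact (hφl s hs).hcap_nonneg (hbl s hs)
  have h0mem : (0 : ℝ) ∈ Ico (0 : ℝ) 1 := ⟨le_rfl, zero_lt_one⟩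
  have hcapl0 : capl 0 = 0 := by
    have h1 := hpt 0 h0mem
    have h2 : (fun n ↦ 2 * (θn n 0 : ℝ)) = fun _ ↦ 0 := funext fun n ↦ by rw [hθ0 n]; simp
    rw [h2, tendsto_const_nhds_iff] at h1
    exact h1.symm
  have h12 : ∀ {s s'} (hs : s ∈ Ico (0 : ℝ) 1) (hs' : s' ∈ Ico (0 : ℝ) 1), s ≤ s' →
      upperHalfPlaneSet \ hpFill (η '' Icc 0 s') ⊆ upperHalfPlaneSet \ hpFill (η '' Icc 0 s) := by
    intro s s' hs hs' hss'
    rw [hVl s hs, hVl s' hs']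
    exact unboundedComponent_anti (image_mono (Icc_subset_Icc_right hss'))
  have hcapl_mono : MonotoneOn capl (Ico 0 1) := by
    intro s hs s' hs' hss'
    rw [hcapl_eq s hs, hcapl_eq s' hs']
    have hQ := (hφl s hs).diffQuotient (hφl s' hs') (hbl s hs) (h12 hs hs' hss')
    have hbQ := (hφl s hs).isBounded_diffImage (hbl s hs) (hbl s' hs')
      (K₂ := hpFill (η '' Icc 0 s'))
    have hnn := hQ.hcap_nonneg hbQ
    rw [(hφl s hs).hcap_diffQuotient (hφl s' hs') (hbl s hs) (hbl s' hs') (h12 hs hs' hss')] at hnn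
    linarith
  have hcapl_strict : StrictMonoOn capl (Ico 0 1) := by
    intro s hs s' hs' hss'
    rw [hcapl_eq s hs, hcapl_eq s' hs']
    exact hstrict s s' hs hs' hss' (φl s hs) (φl s' hs') (hφl s hs) (hφl s' hs')
  have hcapl_cont : ContinuousOn capl (Ico 0 1) := by
    intro s₀ hs₀
    set smax : ℝ := (s₀ + 1) / 2 with hsmax
    have hsmax1 : smax < 1 := by rw [hsmax]; linarith [hs₀.2]
    have hs₀max : s₀ < smax := by rw [hsmax]; linarith [hs₀.2]
    rw [ContinuousWithinAt, tendsto_iff_seq_tendsto]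
    intro x hx
    -- eventually `x k ∈ [0, smax] ∩ [0, 1)`
    have hxev : ∀ᶠ k in atTop, x k ∈ Icc 0 smax ∧ x k ∈ Ico (0 : ℝ) 1 := by
      have h1 : Tendsto x atTop (𝓝 s₀) := hx.mono_right nhdsWithin_le_nhds
      have h2 : ∀ᶠ k in atTop, x k ∈ Ico (0 : ℝ) 1 := hx.eventually eventually_mem_nhdsWithin
      have h3 : ∀ᶠ k in atTop, x k < smax := h1.eventually (gt_mem_nhds hs₀max)
      filter_upwards [h2, h3] with k hk2 hk3
      exact ⟨⟨hk2.1, hk3.le⟩, hk2⟩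
    obtain ⟨N, hN⟩ := eventually_atTop.1 hxev
    set x' : ℕ → ℝ := fun k ↦ x (k + N) with hx'
    have hx'mem : ∀ k, x' k ∈ Icc 0 smax := fun k ↦ (hN (k + N) (Nat.le_add_left N k)).1
    have hx'I : ∀ k, x' k ∈ Ico (0 : ℝ) 1 := fun k ↦ (hN (k + N) (Nat.le_add_left N k)).2
    have hx'lim : Tendsto x' atTop (𝓝 s₀) :=
      (hx.mono_right nhdsWithin_le_nhds).comp (tendsto_add_atTop_nat N)
    -- a common bound `R`
    obtain ⟨R₀, hR₀⟩ := ((isCompact_Icc.image_of_continuousOn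
      (hc.mono (hIcc_sub hsmax1))).isBounded).subset_closedBall 0
    set R : ℝ := |R₀| + 1 with hR
    have hR0 : 0 < R := by positivity
    have hsubR : ∀ s ∈ Icc 0 smax, η '' Icc 0 s ⊆ closedBall (0 : ℂ) R := fun s hs ↦
      (image_mono (Icc_subset_Icc_right hs.2)).trans (hR₀.trans (closedBall_subset_closedBall
        (by rw [hR]; linarith [le_abs_self R₀])))
    have hthick := fun ε (hε : 0 < ε) ↦ eventually_image_Icc_subset_thickening_of_tendsto
      (hc.mono (hIcc_sub hsmax1)) hx'mem ⟨hs₀.1, hs₀max.le⟩ hx'lim hε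
    have key := tendsto_hcap_of_thickening (Sn := fun k ↦ η '' Icc 0 (x' k)) (S := η '' Icc 0 s₀)
      (Kn := fun k ↦ hpFill (η '' Icc 0 (x' k))) (K := hpFill (η '' Icc 0 s₀))
      (φn := fun k ↦ φl (x' k) (hx'I k)) (φ := φl s₀ hs₀) hR0 (hsubR s₀ ⟨hs₀.1, hs₀max.le⟩)
      (fun k ↦ hsubR (x' k) (hx'mem k)) (hVl s₀ hs₀) (fun k ↦ hVl (x' k) (hx'I k)) (hφl s₀ hs₀)
      (fun k ↦ hφl (x' k) (hx'I k)) (fun ε hε ↦ (hthick ε hε).mono fun k hk ↦ hk.1)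
      (fun ε hε ↦ (hthick ε hε).mono fun k hk ↦ hk.2)
    have key' : Tendsto (fun k ↦ capl (x' k)) atTop (𝓝 (capl s₀)) := by
      rw [hcapl_eq s₀ hs₀]
      exact key.congr fun k ↦ (hcapl_eq (x' k) (hx'I k)).symm
    exact (tendsto_add_atTop_iff_nat N).1 key'
  have hcapl_div : Tendsto capl (𝓝[<] 1) atTop := by
    rw [Filter.tendsto_atTop]
    intro M
    obtain ⟨s, hs, hM⟩ := hdiv M
    have hM' : M ≤ capl s := by rw [hcapl_eq s hs]; exact hM _ (hφl s hs)
    filter_upwards [Ico_mem_nhdsLT hs.2] with s' hs'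
    exact hM'.trans (hcapl_mono hs ⟨hs.1.trans hs'.1, hs'.2⟩ hs'.1)
  /- Step E: the limit clock `θ = capl / 2` -/
  set θ : ℝ → ℝ≥0 := fun s ↦ (capl s / 2).toNNReal with hθdef
  have hθcoe : ∀ s (hs : s ∈ Ico (0 : ℝ) 1), (θ s : ℝ) = capl s / 2 := fun s hs ↦ by
    simp only [hθdef]
    rw [Real.coe_toNNReal _ (by linarith [hcapl_nonneg s hs])]
  have hθcont : ContinuousOn θ (Ico 0 1) :=
    continuous_real_toNNReal.comp_continuousOn (hcapl_cont.div_const 2)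
  have hθstrict : StrictMonoOn θ (Ico 0 1) := by
    intro s hs s' hs' hss'
    have h := hcapl_strict hs hs' hss'
    have h' : 0 < capl s' / 2 := by linarith [hcapl_nonneg s hs]
    change (capl s / 2).toNNReal < (capl s' / 2).toNNReal
    rw [Real.toNNReal_lt_toNNReal_iff h']
    linarith
  have hθmono' : MonotoneOn θ (Ico 0 1) := hθstrict.monotoneOn
  have hθzero : θ 0 = 0 := by simp [hθdef, hcapl0]
  have hθdiv : Tendsto θ (𝓝[<] 1) atTop :=
    tendsto_real_toNNReal_atTop.comp (hcapl_div.atTop_div_const (by norm_num))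
  /- Step F: the clocks converge uniformly on `[0, s]` (Pólya) -/
  have hclock : ∀ s ∈ Ico (0 : ℝ) 1,
      TendstoUniformlyOn (fun n u ↦ (θn n u : ℝ)) (fun u ↦ (θ u : ℝ)) atTop (Icc 0 s) := by
    intro s hs
    refine tendstoUniformlyOn_Icc_of_monotoneOn (fun n ↦ ?_) ?_ ?_
    · intro u hu v hv huv
      exact_mod_cast hθmono n (hIcc_sub hs.2 hu) (hIcc_sub hs.2 hv) huv
    · exact NNReal.continuous_coe.comp_continuousOn (hθcont.mono (hIcc_sub hs.2))
    · intro u hu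
      have huI := hIcc_sub hs.2 hu
      rw [hθcoe u huI]
      have := (hpt u huI).div_const 2
      refine this.congr fun n ↦ ?_
      ring
  /- Step G: the inverse clocks -/
  have hbr : ∀ {f : ℝ → ℝ≥0}, ContinuousOn f (Ico 0 1) → StrictMonoOn f (Ico 0 1) → f 0 = 0 →
      Tendsto f (𝓝[<] 1) atTop →
      ∃ σ : ℝ → ℝ, (∀ y, 0 ≤ y → σ y ∈ Ico (0 : ℝ) 1 ∧ (f (σ y) : ℝ) = y) ∧ σ 0 = 0 ∧
        (∀ s ∈ Ico (0 : ℝ) 1, σ (f s) = s) ∧ StrictMonoOn σ (Ici 0) ∧ ContinuousOn σ (Ici 0) := by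
    intro f hfc hfm hf0 hfinf
    have hbc : ContinuousOn (fun s ↦ 2 * (f s : ℝ)) (Ico 0 1) :=
      (continuous_const.mul NNReal.continuous_coe).comp_continuousOn hfc
    have hbm : StrictMonoOn (fun s ↦ 2 * (f s : ℝ)) (Ico 0 1) := fun s hs s' hs' h ↦ by
      have := hfm hs hs' h
      have h' : (f s : ℝ) < f s' := by exact_mod_cast this
      simp only
      linarith
    have hbinf : Tendsto (fun s ↦ 2 * (f s : ℝ)) (𝓝[<] 1) atTop :=
      (NNReal.tendsto_coe_atTop.2 hfinf).const_mul_atTop two_pos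
    obtain ⟨σ, h1, h2, h3, h4, h5⟩ := USTPeano.exists_capacityInverse one_pos
      (b := fun s ↦ 2 * (f s : ℝ)) (by simp [hf0]) hbc hbm hbinf
    refine ⟨σ, fun y hy ↦ ⟨(h1 y hy).1, ?_⟩, h2, fun s hs ↦ ?_, h4, h5⟩
    · have h' : 2 * (f (σ y) : ℝ) = 2 * y := (h1 y hy).2
      linarith
    · have h' : σ (2 * (f s : ℝ) / 2) = s := h3 s hs
      rwa [mul_div_cancel_left₀ _ (two_ne_zero' ℝ)] at h'
  obtain ⟨σ, hσ1, hσ0, hσ3, hσ4, hσ5⟩ := hbr hθcont hθstrict hθzero hθdiv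
  have hexσn : ∀ n, ∃ σ : ℝ → ℝ, (∀ y, 0 ≤ y → σ y ∈ Ico (0 : ℝ) 1 ∧ (θn n (σ y) : ℝ) = y) ∧
      σ 0 = 0 ∧ (∀ s ∈ Ico (0 : ℝ) 1, σ (θn n s) = s) ∧ StrictMonoOn σ (Ici 0) ∧
      ContinuousOn σ (Ici 0) := fun n ↦ hbr (hθc n) (hθm n) (hθ0 n) (hθinf n)
  choose σn hσn1 hσn0 hσn3 hσn4 hσn5 using hexσn
  /- Step H: the inverse clocks converge uniformly on every `[0, T]` -/
  have hσconv : ∀ T, 0 ≤ T → TendstoUniformlyOn σn σ atTop (Icc 0 T) := by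
    intro T hT
    refine tendstoUniformlyOn_inverse_clock (θ := fun s ↦ (θ s : ℝ)) (θn := fun n s ↦ (θn n s : ℝ))
      (fun s hs s' hs' h ↦ by exact_mod_cast hθstrict hs hs' h) (by simp [hθzero]) hσ1 hσ5
      (fun n s hs s' hs' h ↦ by exact_mod_cast hθm n hs hs' h) hσn1 (fun s hs1 ↦ ?_) hT
    rcases lt_or_ge s 0 with h | h
    · rw [Icc_eq_empty (not_le.2 h)]
      exact tendstoUniformlyOn_empty
    · exact hclock s ⟨h, hs1⟩
  /- Step I: the capacity parametrisation of the limit and its approximation -/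
  set γ : ℝ≥0 → ℂ := fun u ↦ η (σ u) with hγdef
  have hγθ' : ∀ u ∈ Ico (0 : ℝ) 1, γ (θ u) = η u := fun u hu ↦ by
    simp only [hγdef]
    rw [hσ3 u hu]
  have hσcont' : Continuous fun u : ℝ≥0 ↦ σ u :=
    hσ5.comp_continuous NNReal.continuous_coe fun u ↦ u.2
  have hγc : Continuous γ := hc.comp_continuous hσcont' fun u ↦ (hσ1 u u.2).1
  have hγn_eq : ∀ n (u : ℝ≥0), γn n u = ηn n (σn n u) := by
    intro n u
    have h := hγθ n (σn n u) (hσn1 n u u.2).1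
    have e : θn n (σn n u) = u := NNReal.eq (hσn1 n u u.2).2
    rwa [e] at h
  have hγlim : TendstoLocallyUniformly γn γ atTop := by
    rw [tendstoLocallyUniformly_iff_forall_isCompact]
    intro C hC
    obtain ⟨r, hr⟩ := hC.isBounded.subset_closedBall 0
    set T : ℝ := max r 0 with hT
    have hT0 : 0 ≤ T := le_max_right _ _
    have hCT : ∀ u ∈ C, (u : ℝ) ∈ Icc 0 T := fun u hu ↦ by
      refine ⟨u.2, ?_⟩
      have h := hr hu
      rw [mem_closedBall, NNReal.dist_eq, NNReal.coe_zero, sub_zero, NNReal.abs_eq] at h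
      exact h.trans (le_max_left _ _)
    -- the piece `[0, s₁]`, `s₁ = σ (T + 1)`, carrying all the reparametrisations on `[0, T]`
    obtain ⟨hs₁, -⟩ := hσ1 (T + 1) (by linarith)
    set s₁ : ℝ := σ (T + 1) with hs₁def
    have hσmem : ∀ u ∈ Icc 0 T, σ u ∈ Icc 0 s₁ := fun u hu ↦
      ⟨(hσ1 u hu.1).1.1, hσ4.monotoneOn (show (u : ℝ) ∈ Ici 0 from hu.1)
        (show T + 1 ∈ Ici (0 : ℝ) by change (0 : ℝ) ≤ T + 1; linarith) (by linarith [hu.2])⟩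
    have hmargin : σ T < s₁ := hσ4 (show T ∈ Ici (0 : ℝ) from hT0)
      (show T + 1 ∈ Ici (0 : ℝ) by change (0 : ℝ) ≤ T + 1; linarith) (by linarith)
    have hσnmem : ∀ᶠ n in atTop, ∀ u ∈ Icc 0 T, σn n u ∈ Icc 0 s₁ := by
      filter_upwards [(Metric.tendstoUniformlyOn_iff.1 (hσconv T hT0)) (s₁ - σ T) (by linarith)]
        with n hn u hu
      refine ⟨(hσn1 n u hu.1).1.1, ?_⟩
      have h1 := hn u hu
      rw [Real.dist_eq, abs_lt] at h1
      have h2 : σ u ≤ σ T := hσ4.monotoneOn (show (u : ℝ) ∈ Ici 0 from hu.1)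
        (show T ∈ Ici (0 : ℝ) from hT0) hu.2
      linarith
    have hreal := tendstoUniformlyOn_comp_clock (hc.mono (hIcc_sub hs₁.2)) (hlim s₁ hs₁.2)
      (hσconv T hT0) hσmem hσnmem
    rw [Metric.tendstoUniformlyOn_iff] at hreal ⊢
    intro ε hε
    filter_upwards [hreal ε hε] with n hn u hu
    rw [hγn_eq n u]
    exact hn (u : ℝ) (hCT u hu)
  /- Step J: Lawler–Schramm–Werner's Lemma 3.14 -/
  have hgenW : Loewner.IsGeneratedByCurve W γ :=
    Loewner.isGeneratedByCurve_of_tendstoLocallyUniformly' hWn hW hWlim hgen hγlim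
  exact ⟨θ, γ, hθcont, hθstrict, hθzero, hθdiv, hγθ', hγc, hgenW, hγlim, hclock⟩


/-- **Monotonicity of the capacity of the fills of initial segments**: for `s ≤ s'` in `[0, 1)`
and any hydrodynamic maps, `hcap (Fill η[0, s]) ≤ hcap (Fill η[0, s'])` (the difference is the
capacity of the quotient hull, Lawler (2005), (3.9)). [cite: Lawler2005, §3.4 (3.9)] -/
theorem hcap_hpFill_image_Icc_mono {η : ℝ → ℂ} (hc : ContinuousOn η (Ico 0 1))
    {s s' : ℝ} (hs : s ∈ Ico (0 : ℝ) 1) (hs' : s' ∈ Ico (0 : ℝ) 1) (hss' : s ≤ s')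
    {φ : ConformalEquiv (upperHalfPlaneSet \ hpFill (η '' Icc 0 s)) upperHalfPlaneSet}
    {φ' : ConformalEquiv (upperHalfPlaneSet \ hpFill (η '' Icc 0 s')) upperHalfPlaneSet}
    (hφ : IsHydrodynamicMap (hpFill (η '' Icc 0 s)) φ)
    (hφ' : IsHydrodynamicMap (hpFill (η '' Icc 0 s')) φ') :
    hcap (hpFill (η '' Icc 0 s)) φ ≤ hcap (hpFill (η '' Icc 0 s')) φ' := by
  have hIcc_sub : ∀ {s : ℝ}, s < 1 → Icc (0 : ℝ) s ⊆ Ico 0 1 := fun hs u hu ↦ ⟨hu.1, hu.2.trans_lt hs⟩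
  have hSc : ∀ {s : ℝ}, s < 1 → IsCompact (η '' Icc 0 s) := fun hs ↦
    isCompact_Icc.image_of_continuousOn (hc.mono (hIcc_sub hs))
  have hbl : ∀ {s : ℝ}, s < 1 → IsBounded (hpFill (η '' Icc 0 s) ∩ upperHalfPlaneSet) := fun hs ↦
    (isBounded_hpFill (hSc hs).isBounded).subset inter_subset_left
  have h12 : upperHalfPlaneSet \ hpFill (η '' Icc 0 s') ⊆ upperHalfPlaneSet \ hpFill (η '' Icc 0 s) := by
    rw [diff_hpFill (hSc hs.2).isClosed (hSc hs.2).isBounded,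
      diff_hpFill (hSc hs'.2).isClosed (hSc hs'.2).isBounded]
    exact unboundedComponent_anti (image_mono (Icc_subset_Icc_right hss'))
  have hQ := hφ.diffQuotient hφ' (hbl hs.2) h12
  have hbQ := hφ.isBounded_diffImage (hbl hs.2) (hbl hs'.2) (K₂ := hpFill (η '' Icc 0 s'))
  have hnn := hQ.hcap_nonneg hbQ
  rw [hφ.hcap_diffQuotient hφ' (hbl hs.2) (hbl hs'.2) h12] at hnn
  linarith

/-- **Strict growth of the capacity from an exit point**: if some `η(u)`, `u ∈ (s, s']`, lies in
`ℍ` outside the fill of `η[0, s]`, then `hcap (Fill η[0, s]) < hcap (Fill η[0, s'])` (the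
quotient hull has a point in `ℍ`, hence positive capacity, Lawler (2005), (3.8)–(3.10)).
[cite: Lawler2005, §3.4 (3.10)] -/
theorem hcap_hpFill_image_Icc_lt_of_exit {η : ℝ → ℂ} (hc : ContinuousOn η (Ico 0 1))
    {s s' : ℝ} (hs : s ∈ Ico (0 : ℝ) 1) (hs' : s' ∈ Ico (0 : ℝ) 1) (hss' : s < s')
    {u : ℝ} (hu : u ∈ Ioc s s') (huV : η u ∈ upperHalfPlaneSet \ hpFill (η '' Icc 0 s))
    {φ : ConformalEquiv (upperHalfPlaneSet \ hpFill (η '' Icc 0 s)) upperHalfPlaneSet}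
    {φ' : ConformalEquiv (upperHalfPlaneSet \ hpFill (η '' Icc 0 s')) upperHalfPlaneSet}
    (hφ : IsHydrodynamicMap (hpFill (η '' Icc 0 s)) φ)
    (hφ' : IsHydrodynamicMap (hpFill (η '' Icc 0 s')) φ') :
    hcap (hpFill (η '' Icc 0 s)) φ < hcap (hpFill (η '' Icc 0 s')) φ' := by
  have hIcc_sub : ∀ {s : ℝ}, s < 1 → Icc (0 : ℝ) s ⊆ Ico 0 1 := fun hs u hu ↦ ⟨hu.1, hu.2.trans_lt hs⟩
  have hSc : ∀ {s : ℝ}, s < 1 → IsCompact (η '' Icc 0 s) := fun hs ↦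
    isCompact_Icc.image_of_continuousOn (hc.mono (hIcc_sub hs))
  have hbl : ∀ {s : ℝ}, s < 1 → IsBounded (hpFill (η '' Icc 0 s) ∩ upperHalfPlaneSet) := fun hs ↦
    (isBounded_hpFill (hSc hs).isBounded).subset inter_subset_left
  have h12 : upperHalfPlaneSet \ hpFill (η '' Icc 0 s') ⊆ upperHalfPlaneSet \ hpFill (η '' Icc 0 s) := by
    rw [diff_hpFill (hSc hs.2).isClosed (hSc hs.2).isBounded,
      diff_hpFill (hSc hs'.2).isClosed (hSc hs'.2).isBounded]
    exact unboundedComponent_anti (image_mono (Icc_subset_Icc_right hss'.le))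
  have hQ := hφ.diffQuotient hφ' (hbl hs.2) h12
  have hbQ := hφ.isBounded_diffImage (hbl hs.2) (hbl hs'.2) (K₂ := hpFill (η '' Icc 0 s'))
  have hne : (diffImage φ (hpFill (η '' Icc 0 s')) ∩ upperHalfPlaneSet).Nonempty := by
    refine ⟨φ (η u), ⟨η u, ⟨huV, ?_⟩, rfl⟩, φ.mapsTo huV⟩
    exact inter_subset_hpFill _ ⟨⟨u, ⟨hs.1.trans hu.1.le, hu.2⟩, rfl⟩, huV.1⟩
  have hpos := hQ.hcap_pos hbQ hne
  rw [hφ.hcap_diffQuotient hφ' (hbl hs.2) (hbl hs'.2) h12] at hpos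
  linarith

/-- **Kemppainen–Smirnov's Lemma A.4 (limits of Loewner-parametrised curves are Loewner
curves), tree form.** Let `η_n : [0, 1) → ℂ` be curves with capacity clocks
`θ_n : [0, 1) → [0, ∞)` (continuous, strictly increasing, `θ_n 0 = 0`, `θ_n → ∞` at `1`) and
capacity parametrisations `γ̂_n : [0, ∞) → ℂ`, `γ̂_n (θ_n u) = η_n u`, generating the chordal
Loewner chains of continuous driving functions `W_n` (so `hcap η_n[0, u] = 2 θ_n u`; the data of
`USTPeano.exists_capacity_parametrisation` for simple curves). Suppose `η_n → η` uniformly on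
every `[0, s]`, `s < 1`, where `η` is continuous on `[0, 1)` with `im η(0) = 0`; suppose the
capacity of the limit grows strictly — for `s < s'` some point `η(u)`, `u ∈ (s, s']`, lies in `ℍ`
outside the fill of `η[0, s]` — and tends to `∞` as `s ↑ 1`; and suppose `W_n → W` locally
uniformly, `W` continuous. Then there are the limit clock `θ` (continuous, strictly increasing on
`[0, 1)`, `θ 0 = 0`, `θ → ∞`, and **`θ_n → θ` uniformly on every `[0, s]`**) and the capacity
parametrisation `γ̂` of `η` (`γ̂ (θ u) = η u`, continuous) such that **`γ̂_n → γ̂` locally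
uniformly and the Loewner chain of `W` is generated by `γ̂`**. (KS: "`υ_n → υ` uniformly"
(Lemma A.2), "`υ_n⁻¹` converges uniformly to `υ⁻¹`", "`γ_n ∘ υ_n⁻¹` converges uniformly to
`γ ∘ υ⁻¹`", "Hence `g_t` is generated by `γ` and driven by `W`" — here through
Lawler–Schramm–Werner's Lemma 3.14, `Loewner.isGeneratedByCurve_of_tendstoLocallyUniformly'`.)
[cite: KemppainenSmirnov2017, App. A Lemma A.4] [cite: LawlerSchrammWerner2004, Lemma 3.14] -/
theorem exists_capacity_parametrisation_of_limit
    {ηn : ℕ → ℝ → ℂ} {η : ℝ → ℂ} {θn : ℕ → ℝ → ℝ≥0} {γn : ℕ → ℝ≥0 → ℂ}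
    {Wn : ℕ → ℝ≥0 → ℝ} {W : ℝ≥0 → ℝ}
    (hθc : ∀ n, ContinuousOn (θn n) (Ico 0 1)) (hθm : ∀ n, StrictMonoOn (θn n) (Ico 0 1))
    (hθ0 : ∀ n, θn n 0 = 0) (hθinf : ∀ n, Tendsto (θn n) (𝓝[<] 1) atTop)
    (hγθ : ∀ n, ∀ u ∈ Ico (0 : ℝ) 1, γn n (θn n u) = ηn n u)
    (hWn : ∀ n, Continuous (Wn n)) (hgen : ∀ n, Loewner.IsGeneratedByCurve (Wn n) (γn n))
    (h0 : (η 0).im = 0) (hc : ContinuousOn η (Ico 0 1))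
    (hlim : ∀ s, s < 1 → TendstoUniformlyOn ηn η atTop (Icc 0 s))
    (hgrow : ∀ s s', 0 ≤ s → s < s' → s' < 1 →
      ∃ u ∈ Ioc s s', η u ∈ upperHalfPlaneSet \ hpFill (η '' Icc 0 s))
    (hdiv : ∀ M : ℝ, ∃ s ∈ Ico (0 : ℝ) 1,
      ∀ φ : ConformalEquiv (upperHalfPlaneSet \ hpFill (η '' Icc 0 s)) upperHalfPlaneSet,
        IsHydrodynamicMap (hpFill (η '' Icc 0 s)) φ → M ≤ hcap (hpFill (η '' Icc 0 s)) φ)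
    (hW : Continuous W) (hWlim : TendstoLocallyUniformly Wn W atTop) :
    ∃ (θ : ℝ → ℝ≥0) (γ : ℝ≥0 → ℂ), ContinuousOn θ (Ico 0 1) ∧ StrictMonoOn θ (Ico 0 1) ∧
      θ 0 = 0 ∧ Tendsto θ (𝓝[<] 1) atTop ∧ (∀ u ∈ Ico (0 : ℝ) 1, γ (θ u) = η u) ∧
      Continuous γ ∧ Loewner.IsGeneratedByCurve W γ ∧ TendstoLocallyUniformly γn γ atTop ∧
      ∀ s ∈ Ico (0 : ℝ) 1,
        TendstoUniformlyOn (fun n u ↦ (θn n u : ℝ)) (fun u ↦ (θ u : ℝ)) atTop (Icc 0 s) :=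
  exists_capacity_parametrisation_of_limit_core hθc hθm hθ0 hθinf hγθ hWn hgen h0 hc hlim
    (fun s s' hs hs' hss' _ _ hφ hφ' ↦ by
      obtain ⟨u, hu, huV⟩ := hgrow s s' hs.1 hss' hs'.2
      exact hcap_hpFill_image_Icc_lt_of_exit hc hs hs' hss' hu huV hφ hφ')
    hdiv hW hWlim

/-- **Kemppainen–Smirnov's Lemma A.4, tree form, with the divergence of the capacity read off
the imaginary part**: for curves `η_n` in `ℍ̄`, the hypothesis "the capacity of `η[0, s]`
tends to `∞`" of `exists_capacity_parametrisation_of_limit` follows from "`im η` is unbounded on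
`[0, 1)`" (`im_sq_le_two_mul_hcap_of_tendstoUniformlyOn`), e.g. when the limit curve
approaches `∞` inside a sector. [cite: KemppainenSmirnov2017, App. A Lemma A.4] -/
theorem exists_capacity_parametrisation_of_limit_of_im
    {ηn : ℕ → ℝ → ℂ} {η : ℝ → ℂ} {θn : ℕ → ℝ → ℝ≥0} {γn : ℕ → ℝ≥0 → ℂ}
    {Wn : ℕ → ℝ≥0 → ℝ} {W : ℝ≥0 → ℝ}
    (hθc : ∀ n, ContinuousOn (θn n) (Ico 0 1)) (hθm : ∀ n, StrictMonoOn (θn n) (Ico 0 1))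
    (hθ0 : ∀ n, θn n 0 = 0) (hθinf : ∀ n, Tendsto (θn n) (𝓝[<] 1) atTop)
    (hγθ : ∀ n, ∀ u ∈ Ico (0 : ℝ) 1, γn n (θn n u) = ηn n u)
    (hWn : ∀ n, Continuous (Wn n)) (hgen : ∀ n, Loewner.IsGeneratedByCurve (Wn n) (γn n))
    (himn : ∀ n, ∀ u ∈ Ico (0 : ℝ) 1, 0 ≤ (ηn n u).im)
    (h0 : (η 0).im = 0) (hc : ContinuousOn η (Ico 0 1))
    (hlim : ∀ s, s < 1 → TendstoUniformlyOn ηn η atTop (Icc 0 s))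
    (hgrow : ∀ s s', 0 ≤ s → s < s' → s' < 1 →
      ∃ u ∈ Ioc s s', η u ∈ upperHalfPlaneSet \ hpFill (η '' Icc 0 s))
    (hdivIm : ∀ M : ℝ, ∃ s ∈ Ico (0 : ℝ) 1, M ≤ (η s).im)
    (hW : Continuous W) (hWlim : TendstoLocallyUniformly Wn W atTop) :
    ∃ (θ : ℝ → ℝ≥0) (γ : ℝ≥0 → ℂ), ContinuousOn θ (Ico 0 1) ∧ StrictMonoOn θ (Ico 0 1) ∧
      θ 0 = 0 ∧ Tendsto θ (𝓝[<] 1) atTop ∧ (∀ u ∈ Ico (0 : ℝ) 1, γ (θ u) = η u) ∧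
      Continuous γ ∧ Loewner.IsGeneratedByCurve W γ ∧ TendstoLocallyUniformly γn γ atTop ∧
      ∀ s ∈ Ico (0 : ℝ) 1,
        TendstoUniformlyOn (fun n u ↦ (θn n u : ℝ)) (fun u ↦ (θ u : ℝ)) atTop (Icc 0 s) := by
  refine exists_capacity_parametrisation_of_limit hθc hθm hθ0 hθinf hγθ hWn hgen h0 hc hlim
    hgrow (fun M ↦ ?_) hW hWlim
  obtain ⟨s, hs, hM⟩ := hdivIm (Real.sqrt (2 * max M 0))
  refine ⟨s, hs, fun φ hφ ↦ ?_⟩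
  have hIcc_sub : Icc (0 : ℝ) s ⊆ Ico 0 1 := fun u hu ↦ ⟨hu.1, hu.2.trans_lt hs.2⟩
  have hSc : IsCompact (η '' Icc 0 s) := isCompact_Icc.image_of_continuousOn (hc.mono hIcc_sub)
  have hV := diff_hpFill hSc.isClosed hSc.isBounded (S := η '' Icc 0 s)
  have h1 := im_sq_le_two_mul_hcap_of_tendstoUniformlyOn hθc hθm hθ0 hγθ hWn hgen himn hc hs
    (hlim s hs.2) hV hφ
  have h2 : 2 * max M 0 ≤ (η s).im ^ 2 := by
    have h3 : 0 ≤ Real.sqrt (2 * max M 0) := Real.sqrt_nonneg _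
    have h4 : Real.sqrt (2 * max M 0) ^ 2 = 2 * max M 0 := Real.sq_sqrt (by positivity)
    nlinarith [hM, h3, h4]
  linarith [le_max_left M 0]

/-! ### Kemppainen–Smirnov's form: non-constancy and a uniform modulus of the tip approach -/

/-- **Kemppainen–Smirnov's main lemma with their hypotheses (Lemmas A.5 and A.7).** In
`exists_capacity_parametrisation_of_limit`, the strict growth of the limit capacity may be
replaced by the two printed hypotheses: **`η` is not constant on any subinterval of `[0, 1)`**,
and the approximants have a **uniform modulus of the tip approach**: `|f_{n, θ_n u}(W_n(θ_n u) +
iy) - η_n(u)| ≤ ψ(y)` for `0 < y ≤ δ`, all `n` and `u`, with `ψ(y) → 0` as `y ↓ 0` (KS Lemma A.7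
(b); for lattice curves it is the conclusion of their Thm. 3.12). Printed argument (proof of
Lemma A.5): if the capacity were constant on `[s, s']`, then `θ_n u - θ_n s → 0` for
`u ∈ [s, s']`, so by the equicontinuity of Loewner chains (`Loewner.norm_loewnerInv_sub_le`,
`Loewner.norm_loewnerInv_add_sub_le`) and `W_n → W`, `f_{n, θ_n u}(W_n(θ_n u) + iy) -
f_{n, θ_n s}(W_n(θ_n s) + iy) → 0` for every `y > 0`; with the tip modulus,
`|η(u) - η(s)| ≤ 2 ψ(y)` for all small `y`, i.e. `η` is constant on `[s, s']`.
[cite: KemppainenSmirnov2017, App. A Lemmas A.4, A.5, A.7] -/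
theorem exists_capacity_parametrisation_of_limit_of_tipModulus
    {ηn : ℕ → ℝ → ℂ} {η : ℝ → ℂ} {θn : ℕ → ℝ → ℝ≥0} {γn : ℕ → ℝ≥0 → ℂ}
    {Wn : ℕ → ℝ≥0 → ℝ} {W : ℝ≥0 → ℝ}
    (hθc : ∀ n, ContinuousOn (θn n) (Ico 0 1)) (hθm : ∀ n, StrictMonoOn (θn n) (Ico 0 1))
    (hθ0 : ∀ n, θn n 0 = 0) (hθinf : ∀ n, Tendsto (θn n) (𝓝[<] 1) atTop)
    (hγθ : ∀ n, ∀ u ∈ Ico (0 : ℝ) 1, γn n (θn n u) = ηn n u)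
    (hWn : ∀ n, Continuous (Wn n)) (hgen : ∀ n, Loewner.IsGeneratedByCurve (Wn n) (γn n))
    (h0 : (η 0).im = 0) (hc : ContinuousOn η (Ico 0 1))
    (hlim : ∀ s, s < 1 → TendstoUniformlyOn ηn η atTop (Icc 0 s))
    (hnc : ∀ s s', 0 ≤ s → s < s' → s' < 1 → ∃ u ∈ Icc s s', η u ≠ η s)
    {ψ : ℝ → ℝ} {δ : ℝ} (hδ : 0 < δ) (hψ0 : Tendsto ψ (𝓝[>] 0) (𝓝 0))
    (hψ : ∀ n, ∀ u ∈ Ico (0 : ℝ) 1, ∀ y ∈ Ioc (0 : ℝ) δ,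
      ‖Loewner.loewnerInv (Wn n) (θn n u) (Wn n (θn n u) + y * Complex.I) - ηn n u‖ ≤ ψ y)
    (hdiv : ∀ M : ℝ, ∃ s ∈ Ico (0 : ℝ) 1,
      ∀ φ : ConformalEquiv (upperHalfPlaneSet \ hpFill (η '' Icc 0 s)) upperHalfPlaneSet,
        IsHydrodynamicMap (hpFill (η '' Icc 0 s)) φ → M ≤ hcap (hpFill (η '' Icc 0 s)) φ)
    (hW : Continuous W) (hWlim : TendstoLocallyUniformly Wn W atTop) :
    ∃ (θ : ℝ → ℝ≥0) (γ : ℝ≥0 → ℂ), ContinuousOn θ (Ico 0 1) ∧ StrictMonoOn θ (Ico 0 1) ∧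
      θ 0 = 0 ∧ Tendsto θ (𝓝[<] 1) atTop ∧ (∀ u ∈ Ico (0 : ℝ) 1, γ (θ u) = η u) ∧
      Continuous γ ∧ Loewner.IsGeneratedByCurve W γ ∧ TendstoLocallyUniformly γn γ atTop ∧
      ∀ s ∈ Ico (0 : ℝ) 1,
        TendstoUniformlyOn (fun n u ↦ (θn n u : ℝ)) (fun u ↦ (θ u : ℝ)) atTop (Icc 0 s) := by
  refine exists_capacity_parametrisation_of_limit_core hθc hθm hθ0 hθinf hγθ hWn hgen h0 hc hlim
    (fun s s' hs hs' hss' φ φ' hφ hφ' ↦ ?_) hdiv hW hWlim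
  have hIcc_sub : ∀ {s : ℝ}, s < 1 → Icc (0 : ℝ) s ⊆ Ico 0 1 := fun hs u hu ↦ ⟨hu.1, hu.2.trans_lt hs⟩
  refine (hcap_hpFill_image_Icc_mono hc hs hs' hss'.le hφ hφ').lt_of_ne fun heq ↦ ?_
  -- the capacity, hence the clock increments, are constant on `[s, s']`
  have hVs := diff_hpFill (isCompact_Icc.image_of_continuousOn (hc.mono (hIcc_sub hs.2))).isClosed
    (isCompact_Icc.image_of_continuousOn (hc.mono (hIcc_sub hs.2))).isBounded (S := η '' Icc 0 s)
  have hts : Tendsto (fun n ↦ 2 * (θn n s : ℝ)) atTop (𝓝 (hcap (hpFill (η '' Icc 0 s)) φ)) :=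
    tendsto_clock_of_tendstoUniformlyOn hθc hθm hθ0 hγθ hWn hgen hc hs (hlim s hs.2) hVs hφ
  have htu : ∀ u ∈ Icc s s', Tendsto (fun n ↦ 2 * (θn n u : ℝ)) atTop
      (𝓝 (hcap (hpFill (η '' Icc 0 s)) φ)) := by
    intro u hu
    have huI : u ∈ Ico (0 : ℝ) 1 := ⟨hs.1.trans hu.1, hu.2.trans_lt hs'.2⟩
    obtain ⟨ψu, hψu, hVu⟩ := exists_isHydrodynamicMap_hpFill_image_Icc huI.1
      (hc.mono (hIcc_sub huI.2)) h0
    have h1 := hcap_hpFill_image_Icc_mono hc hs huI hu.1 hφ hψu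
    have h2 := hcap_hpFill_image_Icc_mono hc huI hs' hu.2 hψu hφ'
    have hequ : hcap (hpFill (η '' Icc 0 u)) ψu = hcap (hpFill (η '' Icc 0 s)) φ :=
      le_antisymm (h2.trans_eq heq.symm) h1
    rw [← hequ]
    exact tendsto_clock_of_tendstoUniformlyOn hθc hθm hθ0 hγθ hWn hgen hc huI (hlim u huI.2) hVu hψu
  -- the common limit time `θ̄` and the convergence of the driving values there
  set cbar : ℝ := hcap (hpFill (η '' Icc 0 s)) φ with hcbar
  have hθs : Tendsto (fun n ↦ (θn n s : ℝ)) atTop (𝓝 (cbar / 2)) := by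
    have := hts.div_const 2
    simpa using this
  have hθu : ∀ u ∈ Icc s s', Tendsto (fun n ↦ (θn n u : ℝ)) atTop (𝓝 (cbar / 2)) := fun u hu ↦ by
    have := (htu u hu).div_const 2
    simpa using this
  have hcbar0 : 0 ≤ cbar / 2 := by
    have := ge_of_tendsto' hθs fun n ↦ (θn n s).coe_nonneg
    linarith
  set tbar : ℝ≥0 := ⟨cbar / 2, hcbar0⟩ with htbar
  have hθs' : Tendsto (fun n ↦ θn n s) atTop (𝓝 tbar) := by
    rw [← NNReal.tendsto_coe]; exact hθs
  have hθu' : ∀ u ∈ Icc s s', Tendsto (fun n ↦ θn n u) atTop (𝓝 tbar) := fun u hu ↦ by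
    rw [← NNReal.tendsto_coe]; exact hθu u hu
  have hWs : Tendsto (fun n ↦ Wn n (θn n s)) atTop (𝓝 (W tbar)) :=
    hWlim.tendsto_comp (hW.continuousAt) hθs'
  have hWu : ∀ u ∈ Icc s s', Tendsto (fun n ↦ Wn n (θn n u)) atTop (𝓝 (W tbar)) := fun u hu ↦
    hWlim.tendsto_comp (hW.continuousAt) (hθu' u hu)
  -- the key estimate: for `y > 0`, `F_n(u, y) - F_n(s, y) → 0`
  have hkey : ∀ u ∈ Icc s s', ∀ y : ℝ, 0 < y →
      Tendsto (fun n ↦ Loewner.loewnerInv (Wn n) (θn n u) (Wn n (θn n u) + y * Complex.I) -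
        Loewner.loewnerInv (Wn n) (θn n s) (Wn n (θn n s) + y * Complex.I)) atTop (𝓝 0) := by
    intro u hu y hy
    have huI : u ∈ Ico (0 : ℝ) 1 := ⟨hs.1.trans hu.1, hu.2.trans_lt hs'.2⟩
    have hmono : ∀ n, θn n s ≤ θn n u := fun n ↦ (hθm n).monotoneOn hs huI hu.1
    -- the constants
    set T : ℝ := cbar / 2 + 1 with hT
    set C : ℝ := 8 * ((y + 2 * T / y) / y) with hC
    have hC0 : 0 ≤ C := by positivity
    -- eventually the times are `≤ T`, the increments and driving differences small
    have hev1 : ∀ᶠ n in atTop, (θn n u : ℝ) ≤ T :=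
      (hθu u hu).eventually (Iio_mem_nhds (by rw [hT]; linarith)) |>.mono fun n hn ↦ hn.le
    have hr : Tendsto (fun n ↦ (θn n u : ℝ) - θn n s) atTop (𝓝 0) := by
      have := (hθu u hu).sub hθs
      simpa using this
    have hdW : Tendsto (fun n ↦ ((Wn n (θn n u) : ℂ) - Wn n (θn n s))) atTop (𝓝 0) := by
      have h1 := (Complex.continuous_ofReal.tendsto _).comp ((hWu u hu).sub hWs)
      simpa [Function.comp_def] using h1
    have hr2 : Tendsto (fun n ↦ 2 * ((θn n u : ℝ) - θn n s) / y) atTop (𝓝 0) := by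
      have := (hr.const_mul 2).div_const y
      simpa using this
    have hev2 : ∀ᶠ n in atTop, 2 * ((θn n u : ℝ) - θn n s) / y ≤ y / 2 :=
      hr2.eventually_le_const (half_pos hy)
    have hdWn : Tendsto (fun n ↦ ‖((Wn n (θn n u) : ℂ) - Wn n (θn n s))‖) atTop (𝓝 0) :=
      tendsto_zero_iff_norm_tendsto_zero.1 hdW
    have hev3 : ∀ᶠ n in atTop, ‖((Wn n (θn n u) : ℂ) - Wn n (θn n s))‖ ≤ y / 2 :=
      hdWn.eventually_le_const (half_pos hy)
    have hbound : ∀ᶠ n in atTop,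
        ‖Loewner.loewnerInv (Wn n) (θn n u) (Wn n (θn n u) + y * Complex.I) -
            Loewner.loewnerInv (Wn n) (θn n s) (Wn n (θn n s) + y * Complex.I)‖ ≤
          C * ‖((Wn n (θn n u) : ℂ) - Wn n (θn n s))‖ + C * (2 * ((θn n u : ℝ) - θn n s) / y) := by
      filter_upwards [hev1, hev2, hev3] with n h1 h2 h3
      set t : ℝ≥0 := θn n s with ht
      set t' : ℝ≥0 := θn n u with ht'
      set z : ℂ := (Wn n t : ℂ) + y * Complex.I with hzdef
      set z' : ℂ := (Wn n t' : ℂ) + y * Complex.I with hz'def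
      have hz : z.im = y := by simp [hzdef]
      have hzz' : z' - z = (Wn n t' : ℂ) - Wn n t := by rw [hz'def, hzdef]; ring
      have htt' : t ≤ t' := hmono n
      have htT : (t : ℝ) ≤ T := (NNReal.coe_le_coe.2 htt').trans h1
      -- Lipschitz in `z` at time `t'`
      have hA := Loewner.norm_loewnerInv_sub_le (hWn n) t' (z := z) (w := z')
        (by rw [hz]; exact hy) (by rw [hzz', hz]; exact h3)
      -- two-time bound at `z`
      have hcoe : (((t' - t : ℝ≥0)) : ℝ) = (t' : ℝ) - t := NNReal.coe_sub htt'
      have hB := Loewner.norm_loewnerInv_add_sub_le (hWn n) t (t' - t) (z := z)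
        (by rw [hz]; exact hy) (by rw [hcoe, hz]; exact h2)
      rw [add_tsub_cancel_of_le htt', hcoe, hz] at hB
      rw [hz] at hA
      have hKt' : 8 * ((y + 2 * (t' : ℝ) / y) / y) ≤ C := by
        rw [hC]; gcongr
      have hKt : 8 * ((y + 2 * (t : ℝ) / y) / y) ≤ C := by
        rw [hC]; gcongr
      have hΔ : 0 ≤ 2 * ((t' : ℝ) - t) / y := by
        have : (t : ℝ) ≤ t' := NNReal.coe_le_coe.2 htt'
        positivity
      calc ‖Loewner.loewnerInv (Wn n) t' z' - Loewner.loewnerInv (Wn n) t z‖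
          ≤ ‖Loewner.loewnerInv (Wn n) t' z' - Loewner.loewnerInv (Wn n) t' z‖ +
              ‖Loewner.loewnerInv (Wn n) t' z - Loewner.loewnerInv (Wn n) t z‖ :=
            norm_sub_le_norm_sub_add_norm_sub _ _ _
        _ ≤ C * ‖z' - z‖ + C * (2 * ((t' : ℝ) - t) / y) :=
            add_le_add (hA.trans (mul_le_mul_of_nonneg_right hKt' (norm_nonneg _)))
              (hB.trans (mul_le_mul_of_nonneg_right hKt hΔ))
        _ = C * ‖((Wn n t' : ℂ) - Wn n t)‖ + C * (2 * ((t' : ℝ) - t) / y) := by rw [hzz']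
    have hrhs : Tendsto (fun n ↦ C * ‖((Wn n (θn n u) : ℂ) - Wn n (θn n s))‖ +
        C * (2 * ((θn n u : ℝ) - θn n s) / y)) atTop (𝓝 0) := by
      have := (hdWn.const_mul C).add (hr2.const_mul C)
      simpa using this
    exact squeeze_zero_norm' hbound hrhs
  -- `‖η u - η s‖ ≤ 2 ψ y` for `u ∈ [s, s']` and `0 < y ≤ δ`
  have hchain : ∀ u ∈ Icc s s', ∀ y ∈ Ioc (0 : ℝ) δ, ‖η u - η s‖ ≤ 2 * ψ y := by
    intro u hu y hy
    have huI : u ∈ Ico (0 : ℝ) 1 := ⟨hs.1.trans hu.1, hu.2.trans_lt hs'.2⟩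
    set Fu : ℕ → ℂ := fun n ↦
      Loewner.loewnerInv (Wn n) (θn n u) (Wn n (θn n u) + y * Complex.I) with hFu
    set Fs : ℕ → ℂ := fun n ↦
      Loewner.loewnerInv (Wn n) (θn n s) (Wn n (θn n s) + y * Complex.I) with hFs
    have hpt : ∀ n, ‖η u - η s‖ ≤
        ‖η u - ηn n u‖ + ‖Fu n - Fs n‖ + ‖ηn n s - η s‖ + 2 * ψ y := by
      intro n
      have a : ‖ηn n u - Fu n‖ ≤ ψ y := by rw [norm_sub_rev]; exact hψ n u huI y hy
      have b : ‖Fs n - ηn n s‖ ≤ ψ y := hψ n s hs y hy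
      have e : η u - η s = (η u - ηn n u) + (ηn n u - Fu n) + (Fu n - Fs n) + (Fs n - ηn n s) +
          (ηn n s - η s) := by ring
      calc ‖η u - η s‖ ≤ ‖η u - ηn n u‖ + ‖ηn n u - Fu n‖ + ‖Fu n - Fs n‖ + ‖Fs n - ηn n s‖ +
            ‖ηn n s - η s‖ := by
              rw [e]
              refine (norm_add_le _ _).trans (add_le_add ?_ le_rfl)
              refine (norm_add_le _ _).trans (add_le_add ?_ le_rfl)
              refine (norm_add_le _ _).trans (add_le_add ?_ le_rfl)
              exact norm_add_le _ _
        _ ≤ ‖η u - ηn n u‖ + ‖Fu n - Fs n‖ + ‖ηn n s - η s‖ + 2 * ψ y := by linarith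
    have l1 : Tendsto (fun n ↦ ‖η u - ηn n u‖) atTop (𝓝 0) := by
      have h := (hlim s' hs'.2).tendsto_at ⟨hs.1.trans hu.1, hu.2⟩
      have := tendsto_iff_norm_sub_tendsto_zero.1 h
      simpa [norm_sub_rev] using this
    have l2 : Tendsto (fun n ↦ ‖Fu n - Fs n‖) atTop (𝓝 0) :=
      tendsto_zero_iff_norm_tendsto_zero.1 (hkey u hu y hy.1)
    have l3 : Tendsto (fun n ↦ ‖ηn n s - η s‖) atTop (𝓝 0) := by
      have h := (hlim s' hs'.2).tendsto_at ⟨hs.1, hss'.le⟩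
      exact tendsto_iff_norm_sub_tendsto_zero.1 h
    have hl := ((l1.add l2).add l3).add_const (2 * ψ y)
    simp only [zero_add] at hl
    exact ge_of_tendsto' hl hpt
  -- `ψ(y) → 0`: `η` is constant on `[s, s']`, contradicting the non-constancy
  obtain ⟨u, hu, hne⟩ := hnc s s' hs.1 hss' hs'.2
  have hzero : ‖η u - η s‖ ≤ 2 * 0 := by
    refine ge_of_tendsto (hψ0.const_mul 2) ?_
    filter_upwards [Ioc_mem_nhdsGT hδ] with y hy using hchain u hu y hy
  rw [mul_zero, norm_le_zero_iff, sub_eq_zero] at hzero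
  exact hne hzero

end Literature.Probability.RandomPlanarGeometry
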